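import Mathlib.LinearAlgebra.Dimension.Localization
import Mathlib.LinearAlgebra.Dimension.Torsion.Finite
import Mathlib.LinearAlgebra.FreeModule.StrongRankCondition

/-!
# Sketch (stub-ideation k2 g35, `stub_cmLambdaLower` of crux 26074) — the (ii_fin) ↔ K0b (c) trade as ONE kernel `iff`

Seat `sidea-stub_cmLambdaLower-2-g35` (planner, stub-ideation, technique «literature transfer · typed dictionary»).
Card: `Cruxes/ResidualThetaCountLowerPureAtTwo/Ideas/stub-cmlambdalower-k2-g35.md`.  NOTHING registered is touched
(not RSL_g 22608, not 26074, not v8 / v9 / v3h / v3i, not p729510 / p726418 / «Kato125AB»); BSD is not proved by any of this.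

PURPOSE (bookkeeping for item 24115 = `Kato2004.thm12_4_newform` (K0b), NOT a plan on the stub).  The tree holds ONE
direction of the "two-supplier trade" (STUB-PLAN S163 (c1), rows 108/109):
`OnePair.S3BodyOfStations.isTorsion_quotient_span_of_rank_eq_one` — K0b's rank-one clause ⇒ `𝐇¹_Γ/Λ_𝒪 z₀` torsion
(for `z₀` torsion-free, which is FREE on the leaf's path: `S3BodyOfStations.torsionFree_of_column`).  This file proves the
CONVERSE generically and packages both as an `iff`:

* `rank_span_singleton_of_nonTorsion` — `Λ z ≅ Λ` has rank `1` for a torsion-free `z` (any commutative domain `Λ`);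
* `rank_eq_one_of_isTorsion_quotient_span` — **(L1)** `H/Λz` torsion and `z` torsion-free ⇒ `Module.rank Λ H = 1`;
* `isTorsion_quotient_span_iff_rank_eq_one` — the trade as an `iff`.

INSTANTIATION RECIPE (0 new bytes anywhere; all names landed): `Λ := IwasawaAlgebraO (Set.range ι)` (`IsDomain` in tree),
`H := I.H` for `I : IwasawaH1DataCoeff ρ.toGaloisRep 2 κ γ`, `z := z₀` the valued class of «Kato125AB» / child A,
`hz := S3BodyOfStations.torsionFree_of_column …` (stations (E)+(R)), `htors :=` the landed chain
`(ii_fin)(z₀) ⟹ Λ-torsion` (`ColemanSideInjective.isTorsion_of_finite_baseChange` + `not_finite_baseChange_powerSeries_two`,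
the `htors` fed to `s3body_of_stations`).  CONSEQUENCE: once «Kato125AB» is typed, K0b's THIRD conjunct
`Module.rank (IwasawaAlgebraO (Set.range ι)) I.H = 1` is a kernel consequence of the leaf; with seat tp2-p2x-w2 g23's series
(`IwasawaH1DataCoeff.isTorsionFree_newform_of_isIrreducible`, 2026-08-29) K0b's SECOND conjunct is kernel modulo Ribet
irreducibility; only (12.2.1) finite generation stays print-only on 24115's account.  Nothing here is consumed by 22608 / 26074.

References: [Kato2004Asterisque] Thm. 12.4 (2) (p. 221 l. 15–16 of `paper:doi-10-24033-ast-639` p0106), §13.8 (p. 228).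
-/

set_option autoImplicit false
-- the Cruxes namespace of this sub repeats the summit name by design (D-0017 nested layout)
set_option linter.dupNamespace false

universe u v

namespace Summit.BirchSwinnertonDyer.BirchSwinnertonDyer.Cruxes.ResidualThetaCountLowerPureAtTwo.SideaK2G35

variable {Λ : Type u} [CommRing Λ] [IsDomain Λ] {H : Type v} [AddCommGroup H] [Module Λ H]

/-- The line through a torsion-free element has rank one: `a ↦ a • z` is an isomorphism `Λ ≃ Λz`.
[cite: Kato2004Asterisque, Thm. 12.4 (2) (p. 221)] -/
theorem rank_span_singleton_of_nonTorsion (z : H) (hz : ∀ a : Λ, a • z = 0 → a = 0) :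
    Module.rank Λ (Submodule.span Λ ({z} : Set H)) = 1 := by
  have hinj : Function.Injective (LinearMap.toSpanSingleton Λ H z) := by
    intro a b hab
    rw [LinearMap.toSpanSingleton_apply, LinearMap.toSpanSingleton_apply, ← sub_eq_zero, ← sub_smul] at hab
    exact sub_eq_zero.mp (hz _ hab)
  have e : Λ ≃ₗ[Λ] Submodule.span Λ ({z} : Set H) :=
    (LinearEquiv.ofInjective _ hinj).trans
      (LinearEquiv.ofEq _ _ (LinearMap.span_singleton_eq_range Λ H z).symm)
  have he := e.lift_rank_eq
  rw [Module.rank_self, Cardinal.lift_one] at he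
  exact Cardinal.lift_eq_one.mp he.symm

/-- **(L1) The leaf implies K0b's rank-one clause.** Over a commutative domain `Λ`: if `z ∈ H` is torsion-free and the
zeta quotient `H ⧸ Λz` is a torsion module, then `Module.rank Λ H = 1` (rank–nullity over a domain:
`rank (H/Λz) + rank (Λz) = rank H`, i.e. `0 + 1`).  Converse of the tree's
`OnePair.S3BodyOfStations.isTorsion_quotient_span_of_rank_eq_one`. [cite: Kato2004Asterisque, Thm. 12.4 (2) (p. 221)] -/
theorem rank_eq_one_of_isTorsion_quotient_span (z : H) (hz : ∀ a : Λ, a • z = 0 → a = 0)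
    (htors : Module.IsTorsion Λ (H ⧸ Submodule.span Λ ({z} : Set H))) : Module.rank Λ H = 1 := by
  have h0 : Module.rank Λ (H ⧸ Submodule.span Λ ({z} : Set H)) = 0 := rank_eq_zero_iff_isTorsion.mpr htors
  have h2 := rank_quotient_add_rank_of_isDomain (Submodule.span Λ ({z} : Set H))
  rw [h0, rank_span_singleton_of_nonTorsion z hz, zero_add] at h2
  exact h2.symm

/-- **The two-supplier trade as an `iff`.** For a torsion-free `z`: `H ⧸ Λz` is torsion ↔ `Module.rank Λ H = 1`.  On the leaf:
child B's (ii_fin) at the valued class (read as `Λ`-torsion by the landed Coleman-side lemmas) ↔ K0b's third conjunct.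
[cite: Kato2004Asterisque, Thm. 12.4 (2) (p. 221)] -/
theorem isTorsion_quotient_span_iff_rank_eq_one (z : H) (hz : ∀ a : Λ, a • z = 0 → a = 0) :
    Module.IsTorsion Λ (H ⧸ Submodule.span Λ ({z} : Set H)) ↔ Module.rank Λ H = 1 := by
  refine ⟨rank_eq_one_of_isTorsion_quotient_span z hz, fun hrk => ?_⟩
  rw [← rank_eq_zero_iff_isTorsion]
  have h2 := rank_quotient_add_rank_of_isDomain (Submodule.span Λ ({z} : Set H))
  rw [rank_span_singleton_of_nonTorsion z hz, hrk] at h2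
  have hlt : Module.rank Λ (H ⧸ Submodule.span Λ ({z} : Set H)) < Cardinal.aleph0 :=
    lt_of_le_of_lt ((self_le_add_right _ 1).trans_eq h2) Cardinal.one_lt_aleph0
  obtain ⟨m, hm⟩ := Cardinal.lt_aleph0.1 hlt
  rw [hm] at h2 ⊢
  norm_cast at h2
  have hm0 : m = 0 := by omega
  subst hm0
  norm_cast

end Summit.BirchSwinnertonDyer.BirchSwinnertonDyer.Cruxes.ResidualThetaCountLowerPureAtTwo.SideaK2G35
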